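import Literature.MathematicalPhysics.QuantumFieldTheory.Balaban1983to89.Node00.TorusCoverBlockAveragingZd
import Literature.MathematicalPhysics.QuantumFieldTheory.Balaban1983to89.B7SectEFLinearisationRec
import Literature.MathematicalPhysics.QuantumFieldTheory.Balaban1983to89.Node00.ShearedAveragingRecord

/-!
# NODE 00 — THE TORUS→`ℤᵈ` TWIN, FILE 40: the COVER-LIFT DICTIONARY for the (78)–(81) GAUGE-FUNCTION AVERAGES at flat background — NODE 00's
# `gaugeAvgF (loopAvgBlockOp expMeanLogSU j)` ∕ `gaugeAvgIter (loopAvgBlockOp expMeanLogSU)` (the `Nrm` rows of N07's knit of record) ARE, read through the level-`j`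
# covers under `ιSU`, the `ℤᵈ` transcription's GUARDED `savgZG` ∕ `uavgZG L δ_N 1` of `B7SectEFLinearisationRec` §10 EXACTLY (no hypothesis), and its UNGUARDED
# `savgZ` ∕ `uavgZ L 1` of `B7SectCDGaugeAveragesRec` on the small-field domain ([Balaban1985Averaging] (78)–(81)), with FILE 39's top-anchored centre-shift bookkeeping

Cell `pub-ymgap`, width seat `pub-ymgap-dag-n07-w3` generation 9 (the torus push-down lineage), N05-REC road item R7, bridge **(B1)** of the LEAD PEN's proposal (dag-n05-e g35,
cell bus 2026-08-29 02:57Z: «(B1) flat centred gauge average ↔ record (81): for a torus gauge function `g` within the guard …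
`ιSU (gaugeAvgIter (loopAvgBlockOp expMeanLogSU) g j′ y) = uavgZG L δ_N 1 (lift g) j′ (lift y)` … whence `Restr129Z L k ℭ 1 u_m` on the cells ⇒ `NrmOfRecordWide … u A`»),
BOTH in the GUARDED currency of record (§5, exact — the LEAD PEN's `savgZG ∕ uavgZG` of R0b-2 §10, p691879, whose guard reads the same family the `SexpZ` sums over, as suggested
on the bus 03:03Z) AND in the UNGUARDED-under-smallness currency the engine twins run on (§2–§4, LEAD brief (T4)).  `--kind proof --supports stmt-QuantumFields-20541` (K0⁷;
count-neutral; THEOREMS ONLY, 0 `def`).  CONSUMED BY NAME, nothing modified: FILE 39 `Node00.TorusCoverBlockAveragingZd` (`coe_expMeanLogSU_avg_of_small`,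
`coverAt_smul_add_ctrShift_succ`), dag-n05-e's `BlockAveragingZd` (`offZ ctrShift avgIterZ_one avgIterZG_one`), `B7SectCDGaugeAveragesRec` (`SexpZ savgZ R0avgZ uavgZ uavgZ_succ`)
and `B7SectEFLinearisationRec` §10 (`savgZG R0avgZG uavgZG uavgZG_succ savgZG_eq_savgZ_of_small`), n05-a's `B7Eq99Concrete.R0fun_one_left`, dag-n07-e's
`ShearedAveragingFlat` (`gaugeAvgF gaugeAvgIter`) and `TorusCoverLevels` (`coverAt`), dag-n07-w6's `ShearedAveragingRecord` (`loopAvgBlockOp`, `loopAvgBlockOp_eq`), `TorusGeometry`'s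
`Site.blockSite`, `Record11.ιSU`.  [3] = [Balaban1985Averaging]; [6] = [Balaban1985RegularSpaces]; [I] = [Balaban1987RG1].

WHY.  `HThm4Rec`'s last row `NrmOfRecordWide … u A` (N07 MODULE 60′) is the (81)∕[6] (1.29) normalisation «`gaugeAvgIter (loopAvgBlockOp expMeanLogSU) (h̄·w·u⁻¹) j′ y = 1`
on the cells of the meet», a statement about NODE 00's flat gauge-function averages on the TORUS; the N05-REC twin crown will deliver the normalisation of ITS gauge in the
transcription's currency (`Restr129Z := Rbar (zdBlockingZ d L) (bgTZ L U₀)`, n05-d; at `U₀ = 1` the (78)–(80) iterate `uavgZ L 1` of R0b-1).  R7's push-down (D) therefore needs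
the dictionary row «torus `R̄ʲg` = transcription `R̄₀ʲ(lift g)` under the cover», which is THIS FILE — the gauge-function companion of FILE 39's field-average row
`avgIterZG_coverLift_eq_iter`, with the SAME top-anchored centre shifts (the (78) block of the coarse site `z` is `{L·z + offZ r}` in the transcription, `{blockSite y r} =
{L·y + r}` centred at `emb y = L·y + (L−1)∕2` in NODE 00).  The family of (78) is CONTOUR-FREE (block points only), so dag-n05-e's ⚑ LOCATED-N2 (mixed linearisation of the
FRAMED averages) does not touch these rows.

WHAT IS PROVED (kernel; every `Params`, `N ≥ 1`; NO estimate — bookkeeping between two typings).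
§1 `coverAt_add_apply`, ★ `coverAt_add_offZ_eq_blockSite` (`π_j q = emb y ⇒ π_j (q + offZ L r) = blockSite y r`: the transcription's block points cover NODE 00's).
§2 `SexpZ_coverLift_eq` (the exponent `S_g` of the lift at `q` = the uniform mean of `log(g(emb y)⁻¹g(x))` over `B(y)`), `smallBlock_coverLift_iff` (the (78) family's guard in both
   typings, `rfl`-level), `coe_gaugeAvgF_loopAvgBlockOp_of_small` (NODE 00's (78) value on the guard, standing range), ★★ `savgZ_coverLift_eq_gaugeAvgF_of_small` (ONE STEP:
   `savgZ L (ι∘g∘π_j) q = ι((R̄g)(y))` when the block family is inside `δ_N`).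
§3 `SexpZ_translate`, `savgZ_translate` (translations on `ℤᵈ`).
§4 `uavgZ_one_succ` ((80) at flat background: `uavgZ L 1 u (j+1) z = savgZ L (uavgZ L 1 u j) (L·z)`), `savgZ_coverLift_translate_eq_gaugeAvgF_of_small`,
   ★★★ `uavgZ_one_coverLift_eq_gaugeAvgIter_of_small` (for `k ≤ m+K`, ALL `j ≤ k`, top-anchored as FILE 39: `uavgZ L 1 (ι∘g∘π∘(·+(Lᵏ−1)∕2·𝟙)) j = fun w =>
   ι((R̄ʲg)(π_j(w + (L^{k−j}−1)∕2·𝟙)))` whenever every intermediate (78) family of `R̄^{j′}g`, `j′ < k`, is inside `δ_N`), `…_top_of_small` (level `k`, shift-free),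
   ★★ `uavgZ_one_coverLift_eq_one_iff_of_small` (THE (81)∕(1.29) NORMALISATION TRANSFERS: `uavgZ … j w = 1 ↔ R̄ʲg(π_j(w + …)) = 1`, `ι` injective);
   A6: `smallBlocks_gaugeAvgIter_one` (the smallness hypothesis inhabited at `g = 1`), `uavgZ_one_coverLift_one` (both sides `1`).
§5 THE GUARDED EDITIONS — EXACT, NO HYPOTHESIS: `expMeanLogSU_avg_of_not_small` (off the guard NODE 00's inner operation is `1`), ★★ `savgZG_coverLift_eq_gaugeAvgF` (ONE STEP, on AND
   off the guard), `savgZG_translate`, `uavgZG_one_succ`, `savgZG_coverLift_translate_eq_gaugeAvgF`, ★★★ `uavgZG_one_coverLift_eq_gaugeAvgIter` (ALL `j ≤ k ≤ m+K`: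
   `uavgZG L δ_N 1 (ι∘g∘π∘(·+(Lᵏ−1)∕2·𝟙)) j = fun w => ι((R̄ʲg)(π_j(w + (L^{k−j}−1)∕2·𝟙)))`), `…_top`,
   ★★★ `uavgZG_one_coverLift_eq_one_iff` (THE (81)∕(1.29) NORMALISATION TRANSFERS EXACTLY between the two typings).
NOT HERE: general backgrounds `U₀ ≠ 1` ((79)–(80) with `R0fun`'s transporters — not read by `NrmOfRecordWide`); the smallness in §2–§4 is an OUTPUT of the twin crown's
(1.33)-type rows in R7 (D) and is displayed there as a hypothesis; §5 needs none.
HONEST FRAMING: kernel bookkeeping between two typings already in the tree — nothing of Bałaban asserted or discharged; `HThm4Rec` UNDISCHARGED (caveat (C-S3-1) stands);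
N05-REC R1–R7 discharge nothing until the inhabitant of `HThm4RecEx` lands; N07 ∕ N05 NOT discharged, N07 NOT claimable on road (β); counts unmoved (typed 28∕28 · discharged
7∕28); one finite 𝕋⁴ programme at fixed ε — the route closes the conditional finite-𝕋⁴ rung `BalabanLadder.UV` ONLY; the YM mass gap (Clay) is NOT proved by any of this;
nothing continuum ∕ ℝ⁴ ∕ OS.  No `def`, no `sorry`, no `instance`, no `notation`.

References: [3] (78)–(81) p. 30; [6] (1.29) p. 81; [I] (0.1) p. 251, (0.3)–(0.4) pp. 252–253.
-/

set_option autoImplicit false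

noncomputable section

open scoped BigOperators Matrix.Norms.L2Operator

namespace Literature.MathematicalPhysics.QuantumFieldTheory.Balaban1983to89.Node00

open B15Eq112TorusCover (cover cover_apply)
open B14DomainGeom (Pt)
open B7Prop1Explicit (e e_apply hol seg Letter expUnit)
open BlockAveragingZd (offZ IdxZ ctrShift avgIterZ)
open B7SectCDGaugeAveragesRec (SexpZ savgZ R0avgZ uavgZ uavgZ_succ)
open B7SectEFLinearisationRec (savgZG R0avgZG uavgZG uavgZG_succ)
open ExpMeanLog (expMeanLogSU deltaSU)

variable {P : Params}

/-! ## §1  Block points under the cover: `π_j (q + n_r) = blockSite y r` over the centre `π_j q = emb y` -/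

section BlockPoints

/-- The level-`j` cover is additive in the label: `π_j (q + v) = π_j q + v` coordinatewise. [cite: Balaban1987RG1, (0.1) p.251] -/
theorem coverAt_add_apply (j : ℕ) (q v : Pt P.d) (μ : Fin P.d) :
    coverAt P j (q + v) μ = coverAt P j q μ + ((v μ : ℤ) : ZMod (P.sitesPerDir j)) := by
  simp [coverAt_apply]

/-- **THE BLOCK POINTS UNDER THE COVER** ([I] (0.3) «x − y = Σ_μ δ n_μ e_μ, |n_μ| ≦ (L−1)∕2»): over the centre `π_j q = emb y` of the block of `y`, the translate of the base point by
the centred offset `n_r = offZ L r = r − (L−1)∕2` covers NODE 00's block point `blockSite y r` (label `L·y + r`). [cite: Balaban1987RG1, (0.3) p.252] -/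
theorem coverAt_add_offZ_eq_blockSite {j : ℕ} {q : Pt P.d} {y : Site P (j + 1)} (hq : coverAt P j q = emb y) (r : Fin P.d → Fin P.L) :
    coverAt P j (q + offZ P.L r) = Site.blockSite y r := by
  funext μ
  rw [coverAt_add_apply, hq]
  simp only [emb, Site.blockSite, BlockAveragingZd.offZ_apply, Nat.cast_add, Nat.cast_mul, Int.cast_sub, Int.cast_natCast]
  ring

end BlockPoints

/-! ## §2  One step (78) at flat background: `savgZ` of the lift = `gaugeAvgF (loopAvgBlockOp expMeanLogSU j)` on the small-field domain -/

section OneStep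

variable {j : ℕ} (N : ℕ) [NeZero N]

omit [NeZero N] in
/-- The exponent `S_g` of (78) under the cover: at a base point over `emb y`, `SexpZ` of the lift `ι ∘ g ∘ π_j` is the uniform mean over the block `B(y)` of
`log (g(emb y)⁻¹ g(x))` — NODE 00's (78) family `{g(y)⁻¹g(x)}_{x∈B(y)}` (`loopAvgBlockOp`'s family). [cite: Balaban1985Averaging, (78) p.30; Balaban1987RG1, (0.3) p.252] -/
theorem SexpZ_coverLift_eq (g : GaugeTransf P j (SU N)) {q : Pt P.d} {y : Site P (j + 1)} (hq : coverAt P j q = emb y) :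
    SexpZ P.L (fun x => ιSU N (g (coverAt P j x))) q =
      ∑ r : Fin P.d → Fin P.L, (((P.L : ℝ) ^ P.d)⁻¹) • MatrixLog.mlog ((((g (emb y))⁻¹ * g (Site.blockSite y r) : SU N)) : MatA N) := by
  unfold SexpZ
  refine Finset.sum_congr rfl fun r _ => ?_
  dsimp only
  rw [coverAt_add_offZ_eq_blockSite hq r, hq, ← map_inv, ← map_mul]
  rfl

/-- **THE (78) GUARD, BOTH TYPINGS**: the block family `{g(emb y)⁻¹g(x)}_{x∈B(y)}` is inside NODE 00's radius `δ_N` iff the transcription's family `(g̃ q)⁻¹ g̃(q + n_r)` of the lift is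
(`dist1 = ‖· − 1‖`, `rfl`). [cite: Balaban1985Averaging, (78) p.30; Balaban1987RG1, (0.4) p.253] -/
theorem smallBlock_coverLift_iff (g : GaugeTransf P j (SU N)) {q : Pt P.d} {y : Site P (j + 1)} (hq : coverAt P j q = emb y) :
    (∀ r : Fin P.d → Fin P.L, ‖(((ιSU N (g (coverAt P j q)))⁻¹ * ιSU N (g (coverAt P j (q + offZ P.L r))) : (MatA N)ˣ) : MatA N) - 1‖ < deltaSU (Fin N)) ↔
      ∀ r : Fin P.d → Fin P.L, dist1 ((g (emb y))⁻¹ * g (Site.blockSite y r)) < deltaSU (Fin N) := by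
  refine forall_congr' fun r => ?_
  rw [coverAt_add_offZ_eq_blockSite hq r, hq, ← map_inv, ← map_mul]
  rfl

/-- NODE 00's (78) value in the standing range, on the guard: `(R̄g)(y) = g(emb y)·exp[Σ_{x∈B(y)} L^{−d} log g(emb y)⁻¹g(x)]`. [cite: Balaban1985Averaging, (78) p.30] -/
theorem coe_gaugeAvgF_loopAvgBlockOp_of_small (hj : j + 1 ≤ P.m + P.K) (g : GaugeTransf P j (SU N)) (y : Site P (j + 1))
    (hs : ∀ r : Fin P.d → Fin P.L, dist1 ((g (emb y))⁻¹ * g (Site.blockSite y r)) < deltaSU (Fin N)) :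
    ((gaugeAvgF (loopAvgBlockOp expMeanLogSU j) g y : SU N) : MatA N) =
      (g (emb y) : MatA N) * NormedSpace.exp (∑ r : Fin P.d → Fin P.L, (((P.L : ℝ) ^ P.d)⁻¹) •
        MatrixLog.mlog ((((g (emb y))⁻¹ * g (Site.blockSite y r) : SU N)) : MatA N)) := by
  unfold gaugeAvgF
  rw [loopAvgBlockOp_eq expMeanLogSU hj, Submonoid.coe_mul, coe_expMeanLogSU_avg_of_small N _ hs]
  congr 2
  refine Finset.sum_congr rfl fun r _ => ?_
  simp only [Fintype.card_fun, Fintype.card_fin, Nat.cast_pow]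

/-- ★ **ONE STEP OF (78) UNDER THE COVER, flat background, on the small-field domain**: at a base point `q` over `emb y` (standing range), if NODE 00's block family
`{g(emb y)⁻¹g(x)}_{x∈B(y)}` is inside the radius `δ_N`, the transcription's UNGUARDED site average `savgZ` of the lift `ι ∘ g ∘ π_j` at `q` IS the embedded value of
NODE 00's `gaugeAvgF (loopAvgBlockOp expMeanLogSU j) g y` — print's `(R̄g)(y) = g(y)·exp[Σ_{x∈B(y)} L^{−d} log g(y)⁻¹g(x)]`, same block, same weights, same `log`∕`exp`.
[cite: Balaban1985Averaging, (78) p.30; Balaban1987RG1, (0.3)–(0.4) pp.252–253] -/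
theorem savgZ_coverLift_eq_gaugeAvgF_of_small (hj : j + 1 ≤ P.m + P.K) (g : GaugeTransf P j (SU N)) {q : Pt P.d} {y : Site P (j + 1)}
    (hq : coverAt P j q = emb y) (hs : ∀ r : Fin P.d → Fin P.L, dist1 ((g (emb y))⁻¹ * g (Site.blockSite y r)) < deltaSU (Fin N)) :
    savgZ P.L (fun x => ιSU N (g (coverAt P j x))) q = ιSU N (gaugeAvgF (loopAvgBlockOp expMeanLogSU j) g y) := by
  apply Units.ext
  rw [B7SectCDGaugeAveragesRec.savgZ, Units.val_mul, B7Prop1Explicit.val_expUnit, SexpZ_coverLift_eq N g hq, hq, coe_ιSU, coe_ιSU,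
    coe_gaugeAvgF_loopAvgBlockOp_of_small N hj g y hs]

end OneStep

/-! ## §3  Translations of the (78) objects on `ℤᵈ` -/

section Translate

variable {d : ℕ} (L : ℕ) {𝔸 : Type*} [NormedRing 𝔸] [NormedAlgebra ℂ 𝔸]

/-- The exponent (78) of the translated site function. [cite: Balaban1985Averaging, (78) p.30] -/
theorem SexpZ_translate (g : B7Prop1Explicit.Site d → 𝔸ˣ) (t y : B7Prop1Explicit.Site d) :
    SexpZ L (fun x => g (x + t)) y = SexpZ L g (y + t) := by
  unfold SexpZ
  simp only [add_right_comm]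

variable [CompleteSpace 𝔸]

/-- The site average (78) of the translated site function. [cite: Balaban1985Averaging, (78) p.30] -/
theorem savgZ_translate (g : B7Prop1Explicit.Site d → 𝔸ˣ) (t y : B7Prop1Explicit.Site d) :
    savgZ L (fun x => g (x + t)) y = savgZ L g (y + t) := by
  rw [B7SectCDGaugeAveragesRec.savgZ, B7SectCDGaugeAveragesRec.savgZ, SexpZ_translate]

end Translate

/-! ## §4  The `j`-fold average (79)–(80) at flat background under the cover, TOP-ANCHORED -/

section Iterated

variable (N : ℕ) [NeZero N]

/-- (80) at the FLAT background reads `R̄₀^{j+1}u(z) = {R̄₀^{j}u}(L·z)`: the background transporters of `R0fun` are `1` (`avgIterZ_one`, `R0fun_one_left`).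
[cite: Balaban1985Averaging, (79)–(80) p.30] -/
theorem uavgZ_one_succ {d : ℕ} (L : ℕ) {𝔸 : Type*} [NormedRing 𝔸] [NormedAlgebra ℂ 𝔸] [CompleteSpace 𝔸]
    (u : B7Prop1Explicit.Site d → 𝔸ˣ) (j : ℕ) (z : B7Prop1Explicit.Site d) :
    uavgZ L (1 : B7Prop1Explicit.Site d → Fin d → 𝔸ˣ) u (j + 1) z = savgZ L (uavgZ L 1 u j) ((L : ℤ) • z) := by
  rw [uavgZ_succ, B7SectCDGaugeAveragesRec.R0avgZ, BlockAveragingZd.avgIterZ_one, B7Eq99Concrete.R0fun_one_left]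

/-- The one-step identification of §2 for a TRANSLATED lift `x ↦ ι(g(π_j(x + t)))`. [cite: Balaban1985Averaging, (78) p.30; Balaban1987RG1, (0.3) p.252] -/
theorem savgZ_coverLift_translate_eq_gaugeAvgF_of_small {j : ℕ} (hj : j + 1 ≤ P.m + P.K) (g : GaugeTransf P j (SU N)) (t : Pt P.d) {q : Pt P.d}
    {y : Site P (j + 1)} (hq : coverAt P j (q + t) = emb y) (hs : ∀ r : Fin P.d → Fin P.L, dist1 ((g (emb y))⁻¹ * g (Site.blockSite y r)) < deltaSU (Fin N)) :
    savgZ P.L (fun x => ιSU N (g (coverAt P j (x + t)))) q = ιSU N (gaugeAvgF (loopAvgBlockOp expMeanLogSU j) g y) := by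
  rw [← savgZ_coverLift_eq_gaugeAvgF_of_small N hj g hq hs, ← savgZ_translate]

/-- ★★ **THE `j`-FOLD GAUGE-FUNCTION AVERAGE (79)–(80) AT FLAT BACKGROUND UNDER THE COVER, TOP-ANCHORED, on the small-field domain** (the DICTIONARY row
«`gaugeAvgIter (loopAvgBlockOp expMeanLogSU) ↔ uavgZ L 1`» of the transcription): for `k ≤ m + K` and a finest gauge function `g` lifted at the anchor `(Lᵏ−1)∕2·𝟙`, if every
intermediate (78) block family of NODE 00's iterates `R̄ʲg`, `j < k`, is inside `δ_N`, then for EVERY `j ≤ k` the transcription's unguarded `R̄₀ʲ` of the lift IS the embedded NODE 00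
iterate read through the level-`j` cover anchored at `(L^{k−j}−1)∕2·𝟙` — the same anchoring as FILE 39's field averages.
[cite: Balaban1985Averaging, (79)–(81) p.30; Balaban1987RG1, (0.3)–(0.4) pp.252–253] -/
theorem uavgZ_one_coverLift_eq_gaugeAvgIter_of_small {k : ℕ} (hk : k ≤ P.m + P.K) (g : GaugeTransf P 0 (SU N))
    (hs : ∀ j, j < k → ∀ (y : Site P (j + 1)) (r : Fin P.d → Fin P.L),
      dist1 ((gaugeAvgIter (loopAvgBlockOp expMeanLogSU) g j (emb y))⁻¹ * gaugeAvgIter (loopAvgBlockOp expMeanLogSU) g j (Site.blockSite y r)) < deltaSU (Fin N)) :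
    ∀ j, j ≤ k →
      uavgZ P.L (1 : Pt P.d → Fin P.d → (MatA N)ˣ) (fun x => ιSU N (g (cover P (x + fun _ => ((ctrShift P.L k : ℕ) : ℤ))))) j =
        fun w => ιSU N (gaugeAvgIter (loopAvgBlockOp expMeanLogSU) g j (coverAt P j (w + fun _ => ((ctrShift P.L (k - j) : ℕ) : ℤ))))
  | 0, _ => rfl
  | j + 1, hj => by
    have hj' : j ≤ k := Nat.le_of_succ_le hj
    have hkj : k - j = (k - (j + 1)) + 1 := by omega
    funext w
    rw [uavgZ_one_succ, uavgZ_one_coverLift_eq_gaugeAvgIter_of_small hk g hs j hj', hkj]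
    exact savgZ_coverLift_translate_eq_gaugeAvgF_of_small N (hj.trans hk) (gaugeAvgIter (loopAvgBlockOp expMeanLogSU) g j) _
      (y := coverAt P (j + 1) (w + fun _ => ((ctrShift P.L (k - (j + 1)) : ℕ) : ℤ)))
      (coverAt_smul_add_ctrShift_succ (hj.trans hk) (k - (j + 1)) w) (hs j (Nat.lt_of_succ_le hj) _)

/-- ★★ **THE TOP LEVEL, SHIFT-FREE**: `R̄₀ᵏ(ι∘g∘π∘(·+(Lᵏ−1)∕2·𝟙))(w) = ι((R̄ᵏg)(π_k w))` on the small-field domain.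
[cite: Balaban1985Averaging, (79)–(81) p.30; Balaban1987RG1, (0.3) p.252] -/
theorem uavgZ_one_coverLift_eq_gaugeAvgIter_top_of_small {k : ℕ} (hk : k ≤ P.m + P.K) (g : GaugeTransf P 0 (SU N))
    (hs : ∀ j, j < k → ∀ (y : Site P (j + 1)) (r : Fin P.d → Fin P.L),
      dist1 ((gaugeAvgIter (loopAvgBlockOp expMeanLogSU) g j (emb y))⁻¹ * gaugeAvgIter (loopAvgBlockOp expMeanLogSU) g j (Site.blockSite y r)) < deltaSU (Fin N))
    (w : Pt P.d) :
    uavgZ P.L (1 : Pt P.d → Fin P.d → (MatA N)ˣ) (fun x => ιSU N (g (cover P (x + fun _ => ((ctrShift P.L k : ℕ) : ℤ))))) k w =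
      ιSU N (gaugeAvgIter (loopAvgBlockOp expMeanLogSU) g k (coverAt P k w)) := by
  have h0 : (w + fun _ => ((ctrShift P.L (k - k) : ℕ) : ℤ)) = w := by
    funext μ
    simp [BlockAveragingZd.ctrShift]
  rw [uavgZ_one_coverLift_eq_gaugeAvgIter_of_small N hk g hs k le_rfl]
  simp only [h0]

/-- ★ **THE (81)∕(1.29) NORMALISATION TRANSFERS**: on the small-field domain, «`R̄ʲg = 1` at the level-`j` site `π_j(w + (L^{k−j}−1)∕2·𝟙)`» (NODE 00's reading, the `Nrm` rows of
N07's knit) ↔ «`uavgZ L 1 (lift) j w = 1`» (the transcription's reading) — `ι` is injective. [cite: Balaban1985Averaging, (81) p.30; Balaban1985RegularSpaces, (1.29) p.81] -/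
theorem uavgZ_one_coverLift_eq_one_iff_of_small {k : ℕ} (hk : k ≤ P.m + P.K) (g : GaugeTransf P 0 (SU N))
    (hs : ∀ j, j < k → ∀ (y : Site P (j + 1)) (r : Fin P.d → Fin P.L),
      dist1 ((gaugeAvgIter (loopAvgBlockOp expMeanLogSU) g j (emb y))⁻¹ * gaugeAvgIter (loopAvgBlockOp expMeanLogSU) g j (Site.blockSite y r)) < deltaSU (Fin N))
    {j : ℕ} (hj : j ≤ k) (w : Pt P.d) :
    uavgZ P.L (1 : Pt P.d → Fin P.d → (MatA N)ˣ) (fun x => ιSU N (g (cover P (x + fun _ => ((ctrShift P.L k : ℕ) : ℤ))))) j w = 1 ↔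
      gaugeAvgIter (loopAvgBlockOp expMeanLogSU) g j (coverAt P j (w + fun _ => ((ctrShift P.L (k - j) : ℕ) : ℤ))) = 1 := by
  rw [uavgZ_one_coverLift_eq_gaugeAvgIter_of_small N hk g hs j hj]
  dsimp only
  constructor
  · intro h
    have hinj : Function.Injective (ιSU N) := fun a b hab => by
      apply Subtype.ext
      have := congrArg (fun u : (MatA N)ˣ => (u : MatA N)) hab
      simpa [coe_ιSU] using this
    exact hinj (by rw [h, map_one])
  · intro h
    rw [h, map_one]

/-- **A6 NON-VACUITY of the smallness hypothesis**: at the trivial gauge function `g = 1` every (78) block family of every iterate is the constant family `1`, inside any positive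
radius (`R̄ʲ1 = 1`, dag-n07-w6's `gaugeAvgIter_loopAvgBlockOp_one`). [cite: Balaban1985Averaging, (81) p.30] -/
theorem smallBlocks_gaugeAvgIter_one (k : ℕ) :
    ∀ j, j < k → ∀ (y : Site P (j + 1)) (r : Fin P.d → Fin P.L),
      dist1 ((gaugeAvgIter (loopAvgBlockOp expMeanLogSU) (fun _ : Site P 0 => (1 : SU N)) j (emb y))⁻¹ *
          gaugeAvgIter (loopAvgBlockOp expMeanLogSU) (fun _ : Site P 0 => (1 : SU N)) j (Site.blockSite y r)) < deltaSU (Fin N) := by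
  intro j _ y r
  rw [gaugeAvgIter_loopAvgBlockOp_one expMeanLogSU (expMeanLogSU_E_one' N) j]
  simp only [inv_one, mul_one, GaugeGroup.dist1_one]
  exact ExpMeanLog.deltaSU_pos

/-- **A6**: the top-level identification inhabited at `g = 1` — both sides are `1`. [cite: Balaban1985Averaging, (81) p.30] -/
theorem uavgZ_one_coverLift_one {k : ℕ} (hk : k ≤ P.m + P.K) (w : Pt P.d) :
    uavgZ P.L (1 : Pt P.d → Fin P.d → (MatA N)ˣ) (fun x => ιSU N ((fun _ : Site P 0 => (1 : SU N)) (cover P (x + fun _ => ((ctrShift P.L k : ℕ) : ℤ))))) k w = 1 := by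
  rw [uavgZ_one_coverLift_eq_gaugeAvgIter_top_of_small N hk _ (smallBlocks_gaugeAvgIter_one N k) w,
    gaugeAvgIter_loopAvgBlockOp_one expMeanLogSU (expMeanLogSU_E_one' N) k, map_one]

end Iterated

/-! ## §5  THE GUARDED EDITIONS OF RECORD (`savgZG ∕ uavgZG`, R0b-2 §10): the dictionary is EXACT, on and off the guard — no smallness hypothesis -/

section Guarded

variable (N : ℕ) [NeZero N]

/-- Off the guard NODE 00's inner operation returns `1` (the reindexed family is off the guard too). [cite: Balaban1987RG1, (0.4) p.253] -/
theorem expMeanLogSU_avg_of_not_small {ι : Type*} [Fintype ι] [Nonempty ι] (W : ι → SU N) (hW : ¬ ∀ i, dist1 (W i) < deltaSU (Fin N)) :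
    (expMeanLogSU (n := Fin N)).avg W = 1 := by
  show ExpMeanLog.ESU (W ∘ (LoopAverage.enum ι).symm) = 1
  apply ExpMeanLog.ESU_of_not_small
  intro h
  refine hW fun i => ?_
  have hi := h (LoopAverage.enum ι i)
  simp only [Function.comp_apply, Equiv.symm_apply_apply] at hi
  exact hi

variable {j : ℕ}

/-- ★★ **ONE STEP OF (78) UNDER THE COVER, GUARDED EDITION — EXACT**: at a base point `q` over `emb y` (standing range), the transcription's GUARDED site average `savgZG` at
radius `δ_N` of the lift `ι ∘ g ∘ π_j` IS the embedded value of NODE 00's `gaugeAvgF (loopAvgBlockOp expMeanLogSU j) g y`, on AND off the guard (both guards read the same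
family, `smallBlock_coverLift_iff`; off it both are `g(emb y)·1`). [cite: Balaban1985Averaging, (78) p.30; Balaban1987RG1, (0.4) p.253] -/
theorem savgZG_coverLift_eq_gaugeAvgF (hj : j + 1 ≤ P.m + P.K) (g : GaugeTransf P j (SU N)) {q : Pt P.d} {y : Site P (j + 1)} (hq : coverAt P j q = emb y) :
    savgZG P.L (deltaSU (Fin N)) (fun x => ιSU N (g (coverAt P j x))) q = ιSU N (gaugeAvgF (loopAvgBlockOp expMeanLogSU j) g y) := by
  classical
  have key := smallBlock_coverLift_iff N g hq
  unfold savgZG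
  dsimp only
  split_ifs with h
  · rw [← savgZ_coverLift_eq_gaugeAvgF_of_small N hj g hq (key.mp h)]
    rfl
  · have hs : ¬ ∀ r : Fin P.d → Fin P.L, dist1 ((g (emb y))⁻¹ * g (Site.blockSite y r)) < deltaSU (Fin N) := fun h' => h (key.mpr h')
    unfold gaugeAvgF
    rw [mul_one, loopAvgBlockOp_eq expMeanLogSU hj, expMeanLogSU_avg_of_not_small N _ hs, mul_one, hq]

/-- The guarded site average of the translated site function. [cite: Balaban1985Averaging, (78) p.30] -/
theorem savgZG_translate {d : ℕ} (L : ℕ) {𝔸 : Type*} [NormedRing 𝔸] [NormedAlgebra ℂ 𝔸] [CompleteSpace 𝔸] (δ : ℝ)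
    (g : B7Prop1Explicit.Site d → 𝔸ˣ) (t y : B7Prop1Explicit.Site d) :
    savgZG L δ (fun x => g (x + t)) y = savgZG L δ g (y + t) := by
  classical
  unfold savgZG
  simp only [SexpZ_translate, add_right_comm]

/-- (80) at the FLAT background, guarded edition: `uavgZG L δ 1 u (j+1) z = savgZG L δ (uavgZG L δ 1 u j) (L·z)` (`avgIterZG_one`, `R0fun_one_left`).
[cite: Balaban1985Averaging, (79)–(80) p.30] -/
theorem uavgZG_one_succ {d : ℕ} (L : ℕ) {𝔸 : Type*} [NormedRing 𝔸] [NormedAlgebra ℂ 𝔸] [CompleteSpace 𝔸] (δ : ℝ)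
    (u : B7Prop1Explicit.Site d → 𝔸ˣ) (j : ℕ) (z : B7Prop1Explicit.Site d) :
    uavgZG L δ (1 : B7Prop1Explicit.Site d → Fin d → 𝔸ˣ) u (j + 1) z = savgZG L δ (uavgZG L δ 1 u j) ((L : ℤ) • z) := by
  rw [uavgZG_succ, B7SectEFLinearisationRec.R0avgZG, BlockAveragingZd.avgIterZG_one, B7Eq99Concrete.R0fun_one_left]

/-- The guarded one-step identification for a TRANSLATED lift. [cite: Balaban1985Averaging, (78) p.30; Balaban1987RG1, (0.3) p.252] -/
theorem savgZG_coverLift_translate_eq_gaugeAvgF (hj : j + 1 ≤ P.m + P.K) (g : GaugeTransf P j (SU N)) (t : Pt P.d) {q : Pt P.d} {y : Site P (j + 1)}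
    (hq : coverAt P j (q + t) = emb y) :
    savgZG P.L (deltaSU (Fin N)) (fun x => ιSU N (g (coverAt P j (x + t)))) q = ιSU N (gaugeAvgF (loopAvgBlockOp expMeanLogSU j) g y) := by
  rw [← savgZG_coverLift_eq_gaugeAvgF N hj g hq, ← savgZG_translate]

/-- ★★★ **THE `j`-FOLD GAUGE-FUNCTION AVERAGE OF RECORD (79)–(80) UNDER THE COVER, GUARDED, TOP-ANCHORED — NO HYPOTHESIS** (the DICTIONARY row
«`gaugeAvgIter (loopAvgBlockOp expMeanLogSU) ↔ uavgZG L δ_N 1`»): for `k ≤ m + K`, every finest gauge function `g` and EVERY `j ≤ k`,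
`uavgZG L δ_N 1 (ι∘g∘π∘(·+(Lᵏ−1)∕2·𝟙)) j = fun w => ι((R̄ʲg)(π_j(w + (L^{k−j}−1)∕2·𝟙)))`.
[cite: Balaban1985Averaging, (79)–(81) p.30; Balaban1987RG1, (0.3)–(0.4) pp.252–253] -/
theorem uavgZG_one_coverLift_eq_gaugeAvgIter {k : ℕ} (hk : k ≤ P.m + P.K) (g : GaugeTransf P 0 (SU N)) :
    ∀ j, j ≤ k →
      uavgZG P.L (deltaSU (Fin N)) (1 : Pt P.d → Fin P.d → (MatA N)ˣ) (fun x => ιSU N (g (cover P (x + fun _ => ((ctrShift P.L k : ℕ) : ℤ))))) j =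
        fun w => ιSU N (gaugeAvgIter (loopAvgBlockOp expMeanLogSU) g j (coverAt P j (w + fun _ => ((ctrShift P.L (k - j) : ℕ) : ℤ))))
  | 0, _ => rfl
  | j + 1, hj => by
    have hj' : j ≤ k := Nat.le_of_succ_le hj
    have hkj : k - j = (k - (j + 1)) + 1 := by omega
    funext w
    rw [uavgZG_one_succ, uavgZG_one_coverLift_eq_gaugeAvgIter hk g j hj', hkj]
    exact savgZG_coverLift_translate_eq_gaugeAvgF N (hj.trans hk) (gaugeAvgIter (loopAvgBlockOp expMeanLogSU) g j) _
      (y := coverAt P (j + 1) (w + fun _ => ((ctrShift P.L (k - (j + 1)) : ℕ) : ℤ)))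
      (coverAt_smul_add_ctrShift_succ (hj.trans hk) (k - (j + 1)) w)

/-- ★★ **THE TOP LEVEL, SHIFT-FREE, NO HYPOTHESIS**: `uavgZG L δ_N 1 (ι∘g∘π∘(·+(Lᵏ−1)∕2·𝟙)) k w = ι((R̄ᵏg)(π_k w))`.
[cite: Balaban1985Averaging, (79)–(81) p.30; Balaban1987RG1, (0.3) p.252] -/
theorem uavgZG_one_coverLift_eq_gaugeAvgIter_top {k : ℕ} (hk : k ≤ P.m + P.K) (g : GaugeTransf P 0 (SU N)) (w : Pt P.d) :
    uavgZG P.L (deltaSU (Fin N)) (1 : Pt P.d → Fin P.d → (MatA N)ˣ) (fun x => ιSU N (g (cover P (x + fun _ => ((ctrShift P.L k : ℕ) : ℤ))))) k w =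
      ιSU N (gaugeAvgIter (loopAvgBlockOp expMeanLogSU) g k (coverAt P k w)) := by
  have h0 : (w + fun _ => ((ctrShift P.L (k - k) : ℕ) : ℤ)) = w := by
    funext μ
    simp [BlockAveragingZd.ctrShift]
  rw [uavgZG_one_coverLift_eq_gaugeAvgIter N hk g k le_rfl]
  simp only [h0]

/-- ★★★ **THE (81)∕(1.29) NORMALISATION TRANSFERS EXACTLY**: for `j ≤ k ≤ m + K`, «`uavgZG L δ_N 1 (lift g) j w = 1`» (the transcription's reading of «`ū = 1` on the cells», as the
twin crown will deliver it) ↔ «`R̄ʲg (π_j(w + (L^{k−j}−1)∕2·𝟙)) = 1`» (NODE 00's reading = the `gaugeAvgIter … = 1` row of N07's `NrmOfRecordWide`).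
[cite: Balaban1985Averaging, (81) p.30; Balaban1985RegularSpaces, (1.29) p.81] -/
theorem uavgZG_one_coverLift_eq_one_iff {k : ℕ} (hk : k ≤ P.m + P.K) (g : GaugeTransf P 0 (SU N)) {j : ℕ} (hj : j ≤ k) (w : Pt P.d) :
    uavgZG P.L (deltaSU (Fin N)) (1 : Pt P.d → Fin P.d → (MatA N)ˣ) (fun x => ιSU N (g (cover P (x + fun _ => ((ctrShift P.L k : ℕ) : ℤ))))) j w = 1 ↔
      gaugeAvgIter (loopAvgBlockOp expMeanLogSU) g j (coverAt P j (w + fun _ => ((ctrShift P.L (k - j) : ℕ) : ℤ))) = 1 := by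
  rw [uavgZG_one_coverLift_eq_gaugeAvgIter N hk g j hj]
  dsimp only
  constructor
  · intro h
    have hinj : Function.Injective (ιSU N) := fun a b hab => by
      apply Subtype.ext
      have := congrArg (fun u : (MatA N)ˣ => (u : MatA N)) hab
      simpa [coe_ιSU] using this
    exact hinj (by rw [h, map_one])
  · intro h
    rw [h, map_one]

end Guarded

end Literature.MathematicalPhysics.QuantumFieldTheory.Balaban1983to89.Node00

end
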